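import Mathlib
import Summits.Ventures.PercRepro2.MixChordOCutVertex

/-!
# Zero-weight edges can be deleted: the support transport of `Gc` and of the mixed chord
(blind cell PercRepro2, night-1 g23; proofs/NIGHT1-G23.md §2)

The cell keeps every instance on ONE edge type `E` and models «delete the edge `e`» by `p e = 0`.
The class theorems of the `o`-row (typer-1's pendant identities, the leaf classes of
MixChordOLeafRoot.lean, the cut-vertex lift) are stated for the LITERAL graph — `hleaf : ∀ e, a₃ ∈ ends e
→ e = g` — so an instance whose extra edges at `a₃` merely carry weight `0` (the situation after the
root-edge induction `dChord_of_beta1_of_base` has pinned them) is not literally in any class.  This file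
closes that gap: for a finset `S` of edges carrying every positive weight (`hS : ∀ e ∉ S, p e = 0`),

* `ext S : Config {e // e ∈ S} → Config E` (extension by `false`) and `restrict S p` (the weights on `S`);
* **`prob_restrict`**: `prob p A = prob (restrict S p) (ext S ⁻¹' A)` — the configurations with an edge off
  `S` open carry weight `0`, the others are the image of `ext S`;
* the open graph of `ext S ω` is the open graph of `ω` on the restricted edge type, so every connection
  event pulls back (`preimage_connEvent`, `preimage_avoidAll`, `preimage_PDEvent`, `preimage_TEvent`);
* **`Gc_restrict`**, `HCov_restrict_iff`, the three normalisers, and **`nMixChord_normD_restrict_iff`** /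
  `_normDZ_` / `_normDZ2_`: the `o`-class chords at `p` along `f ∈ S` are the chords of the restricted
  instance along `⟨f, hf⟩`;
* the corollaries — the leaf and cut-vertex classes of the `o`-row IN THE SUPPORT GRAPH — are in
  MixChordSupportClasses.lean.

Own code; standard axioms.
-/

namespace Summit.Ventures.PercRepro2

open UnionCluster CovForm

namespace Mix

namespace Support

section Ext

variable {E : Type*} [DecidableEq E]

/-- Extension of a configuration on the edges of `S` by `false` off `S`. -/
def ext (S : Finset E) (ω : Config {e // e ∈ S}) : Config E :=
  fun e => if h : e ∈ S then ω ⟨e, h⟩ else false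

/-- The restriction of a weight vector to the edges of `S`. -/
def restrict {R : Type*} (S : Finset E) (p : E → R) : {e // e ∈ S} → R := fun e => p e

/-- The restriction of the endpoint map to the edges of `S`. -/
def restrictEnds {V : Type*} (S : Finset E) (ends : E → Sym2 V) : {e // e ∈ S} → Sym2 V :=
  fun e => ends e

/-- `ext S ω` agrees with `ω` on the edges of `S`. -/
lemma ext_apply_of_mem (S : Finset E) (ω : Config {e // e ∈ S}) {e : E} (h : e ∈ S) :
    ext S ω e = ω ⟨e, h⟩ := by
  simp [ext, h]

/-- `ext S ω` is closed off `S`. -/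
lemma ext_apply_of_not_mem (S : Finset E) (ω : Config {e // e ∈ S}) {e : E} (h : e ∉ S) :
    ext S ω e = false := by
  simp [ext, h]

/-- `ext S ω` at a coerced edge of `S`. -/
lemma ext_apply_coe (S : Finset E) (ω : Config {e // e ∈ S}) (e : {e // e ∈ S}) :
    ext S ω e = ω e := by
  rw [ext_apply_of_mem S ω e.2]

/-- `ext S` is injective. -/
lemma ext_injective (S : Finset E) : Function.Injective (ext S) := by
  intro ω₁ ω₂ h
  funext e
  have := congrFun h e
  rwa [ext_apply_coe, ext_apply_coe] at this

/-- A configuration with every edge off `S` closed is an extension. -/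
lemma exists_ext_eq (S : Finset E) {ω : Config E} (h : ∀ e, e ∉ S → ω e = false) :
    ∃ ω₁ : Config {e // e ∈ S}, ext S ω₁ = ω := by
  refine ⟨fun e => ω e, ?_⟩
  funext e
  by_cases he : e ∈ S
  · rw [ext_apply_of_mem S _ he]
  · rw [ext_apply_of_not_mem S _ he, h e he]

omit [DecidableEq E] in
/-- The restricted weights, pointwise. -/
@[simp] lemma restrict_apply {R : Type*} (S : Finset E) (p : E → R) (e : {e // e ∈ S}) :
    restrict S p e = p e := rfl

omit [DecidableEq E] in
/-- The restricted endpoints, pointwise. -/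
@[simp] lemma restrictEnds_apply {V : Type*} (S : Finset E) (ends : E → Sym2 V) (e : {e // e ∈ S}) :
    restrictEnds S ends e = ends e := rfl

/-- Pinning an edge of `S` commutes with the restriction. -/
lemma restrict_update {R : Type*} (S : Finset E) (p : E → R) {f : E} (hf : f ∈ S) (c : R) :
    restrict S (Function.update p f c) = Function.update (restrict S p) ⟨f, hf⟩ c := by
  funext e
  by_cases h : e = ⟨f, hf⟩
  · subst h; simp [restrict]
  · have h' : (e : E) ≠ f := fun h'' => h (Subtype.ext h'')
    simp [restrict, Function.update_of_ne h, Function.update_of_ne h']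

/-- Pinning an edge of `S` keeps the weights off `S` at `0`. -/
lemma update_zero_off {R : Type*} [Zero R] (S : Finset E) {p : E → R} (hS : ∀ e, e ∉ S → p e = 0)
    {f : E} (hf : f ∈ S) (c : R) : ∀ e, e ∉ S → Function.update p f c e = 0 := by
  intro e he
  have : e ≠ f := fun h => he (h ▸ hf)
  rw [Function.update_of_ne this, hS e he]

end Ext

section Prob

variable {E : Type*} [Fintype E] [DecidableEq E] {R : Type*} [CommRing R]

/-- The weight of an extension is the restricted weight. -/
lemma weight_ext (S : Finset E) {p : E → R} (hS : ∀ e, e ∉ S → p e = 0) (ω : Config {e // e ∈ S}) :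
    weight p (ext S ω) = weight (restrict S p) ω := by
  unfold weight
  rw [← Finset.prod_mul_prod_compl S]
  have h2 : ∏ e ∈ Sᶜ, edgeFactor (p e) (ext S ω e) = 1 := by
    refine Finset.prod_eq_one fun e he => ?_
    rw [Finset.mem_compl] at he
    rw [ext_apply_of_not_mem S ω he, hS e he]
    simp
  rw [h2, mul_one, ← Finset.prod_coe_sort S]
  refine Finset.prod_congr rfl fun e _ => ?_
  rw [ext_apply_coe, restrict_apply]

omit [DecidableEq E] in
/-- A configuration with an edge off `S` open has weight `0`. -/
lemma weight_eq_zero_of_open_off (S : Finset E) {p : E → R} (hS : ∀ e, e ∉ S → p e = 0)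
    {ω : Config E} {e : E} (he : e ∉ S) (hω : ω e = true) : weight p ω = 0 := by
  unfold weight
  refine Finset.prod_eq_zero (Finset.mem_univ e) ?_
  rw [hω, hS e he]
  simp

/-- **Support transport of probabilities**: when every weight off `S` vanishes,
`P_p(A) = P_{p|S}(ext S ⁻¹' A)`. -/
theorem prob_restrict (S : Finset E) {p : E → R} (hS : ∀ e, e ∉ S → p e = 0) (A : Set (Config E)) :
    prob p A = prob (restrict S p) (ext S ⁻¹' A) := by
  classical
  unfold prob
  have himg : ∑ ω ∈ (Finset.univ : Finset (Config {e // e ∈ S})).image (ext S), A.indicator (weight p) ω =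
      ∑ ω, A.indicator (weight p) ω := by
    refine Finset.sum_subset (Finset.subset_univ _) fun ω _ hω => ?_
    -- `ω` is not an extension: some edge off `S` is open, so the weight vanishes
    have : ¬ ∀ e, e ∉ S → ω e = false := by
      intro h
      obtain ⟨ω₁, rfl⟩ := exists_ext_eq S h
      exact hω (Finset.mem_image_of_mem _ (Finset.mem_univ _))
    obtain ⟨e, he⟩ := not_forall.1 this
    obtain ⟨he, hωe⟩ := Classical.not_imp.1 he
    have hωe' : ω e = true := by simpa using hωe
    have hw := weight_eq_zero_of_open_off S hS he hωe'
    by_cases hA : ω ∈ A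
    · simp [Set.indicator_of_mem hA, hw]
    · simp [Set.indicator_of_notMem hA]
  rw [← himg, Finset.sum_image (fun ω₁ _ ω₂ _ h => ext_injective S h)]
  refine Finset.sum_congr rfl fun ω _ => ?_
  by_cases hA : ext S ω ∈ A
  · rw [Set.indicator_of_mem hA, Set.indicator_of_mem (Set.mem_preimage.2 hA), weight_ext S hS]
  · rw [Set.indicator_of_notMem hA, Set.indicator_of_notMem (fun h => hA (Set.mem_preimage.1 h))]

end Prob

section Graph

variable {V : Type*} {E : Type*} [DecidableEq E]

/-- Open adjacency transports along `ext`. -/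
lemma openAdj_ext_iff (S : Finset E) (ends : E → Sym2 V) (ω : Config {e // e ∈ S}) (u v : V) :
    OpenAdj ends (ext S ω) u v ↔ OpenAdj (restrictEnds S ends) ω u v := by
  constructor
  · rintro ⟨e, he, hends⟩
    have hmem : e ∈ S := by
      by_contra h
      rw [ext_apply_of_not_mem S ω h] at he
      exact Bool.false_ne_true he
    refine ⟨⟨e, hmem⟩, ?_, hends⟩
    rwa [ext_apply_of_mem S ω hmem] at he
  · rintro ⟨e, he, hends⟩
    exact ⟨e, by rwa [ext_apply_coe], hends⟩

/-- The open graph of an extension is the open graph on the restricted edge type. -/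
lemma openGraph_ext (S : Finset E) (ends : E → Sym2 V) (ω : Config {e // e ∈ S}) :
    openGraph ends (ext S ω) = openGraph (restrictEnds S ends) ω := by
  ext u v
  rw [openGraph_adj, openGraph_adj, openAdj_ext_iff]

/-- Connection transports along `ext`. -/
lemma conn_ext_iff (S : Finset E) (ends : E → Sym2 V) (ω : Config {e // e ∈ S}) (u v : V) :
    Conn ends (ext S ω) u v ↔ Conn (restrictEnds S ends) ω u v := by
  unfold Conn
  rw [openGraph_ext]

/-- Connection events pull back along `ext S`. -/
lemma preimage_connEvent (S : Finset E) (ends : E → Sym2 V) (u v : V) :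
    ext S ⁻¹' connEvent ends u v = connEvent (restrictEnds S ends) u v := by
  ext ω
  simp only [Set.mem_preimage, mem_connEvent, conn_ext_iff]

/-- Avoidance events pull back along `ext S`. -/
lemma preimage_avoidAll [DecidableEq V] (S : Finset E) (ends : E → Sym2 V) (s : V) (X : Finset V) :
    ext S ⁻¹' avoidAll ends s X = avoidAll (restrictEnds S ends) s X := by
  ext ω
  simp only [Set.mem_preimage, avoidAll, Set.mem_setOf_eq, conn_ext_iff]

/-- `{x ∈ Ũ}` pulls back along `ext S`. -/
lemma preimage_inU (S : Finset E) (ends : E → Sym2 V) (a₂ a₃ x : V) :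
    ext S ⁻¹' UnionCluster.inU ends a₂ a₃ x = UnionCluster.inU (restrictEnds S ends) a₂ a₃ x := by
  unfold UnionCluster.inU
  rw [Set.preimage_union, preimage_connEvent, preimage_connEvent]

/-- `{a₃ ∉ Ũ}` pulls back along `ext S`. -/
lemma preimage_Dtilde (S : Finset E) (ends : E → Sym2 V) (a₁ a₂ a₃ : V) :
    ext S ⁻¹' Dtilde ends a₁ a₂ a₃ = Dtilde (restrictEnds S ends) a₁ a₂ a₃ := by
  simp only [Dtilde, Set.preimage_compl, preimage_inU]

/-- `PD` pulls back along `ext S`. -/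
lemma preimage_PDEvent (S : Finset E) (ends : E → Sym2 V) (a₁ a₂ a₃ : V) :
    ext S ⁻¹' PDEvent ends a₁ a₂ a₃ = PDEvent (restrictEnds S ends) a₁ a₂ a₃ := by
  simp only [PDEvent, Set.preimage_inter, Set.preimage_compl, preimage_connEvent, preimage_Dtilde]

/-- `T` pulls back along `ext S`. -/
lemma preimage_TEvent (S : Finset E) (ends : E → Sym2 V) (a₁ a₂ a₃ : V) :
    ext S ⁻¹' TEvent ends a₁ a₂ a₃ = TEvent (restrictEnds S ends) a₁ a₂ a₃ := by
  simp only [TEvent, Set.preimage_inter, Set.preimage_compl, preimage_connEvent]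

end Graph

section Functionals

variable {V : Type*} {E : Type*} [Fintype E] [DecidableEq E] [DecidableEq V] {R : Type*} [Field R]

variable (S : Finset E) {p : E → R} (hS : ∀ e, e ∉ S → p e = 0) (ends : E → Sym2 V)

include hS

/-- **`Gc` only sees the edges of positive weight.** -/
theorem Gc_restrict (o a₁ a₂ a₃ b : V) :
    Gc p ends o a₁ a₂ a₃ b = Gc (restrict S p) (restrictEnds S ends) o a₁ a₂ a₃ b := by
  simp only [Gc, EQbo, EQb3, EQb3o, EQo, EQ3, EQ3o, PDb, PDbo, Do, gap, DEF]
  simp only [prob_restrict S hS, Set.preimage_inter, preimage_connEvent, preimage_avoidAll,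
    preimage_PDEvent, preimage_TEvent]

omit [DecidableEq V] in
/-- `D` only sees the edges of positive weight. -/
theorem normD_restrict (a₁ a₂ a₃ : V) :
    normD ends a₁ a₂ a₃ p = normD (restrictEnds S ends) a₁ a₂ a₃ (restrict S p) := by
  unfold normD
  rw [prob_restrict S hS, preimage_PDEvent]

/-- `D·Z` only sees the edges of positive weight. -/
theorem normDZ_restrict (a₁ a₂ a₃ : V) :
    normDZ ends a₁ a₂ a₃ p = normDZ (restrictEnds S ends) a₁ a₂ a₃ (restrict S p) := by
  unfold normDZ
  rw [prob_restrict S hS, prob_restrict S hS, preimage_PDEvent, preimage_avoidAll]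

/-- `(D·Z)²` only sees the edges of positive weight. -/
theorem normDZ2_restrict (a₁ a₂ a₃ : V) :
    normDZ2 ends a₁ a₂ a₃ p = normDZ2 (restrictEnds S ends) a₁ a₂ a₃ (restrict S p) := by
  unfold normDZ2
  rw [prob_restrict S hS, prob_restrict S hS, preimage_PDEvent, preimage_avoidAll]

variable [LinearOrder R]

/-- (HCOV) only sees the edges of positive weight. -/
theorem HCov_restrict_iff (o a₁ a₂ a₃ b : V) :
    HCov p ends o a₁ a₂ a₃ b ↔ HCov (restrict S p) (restrictEnds S ends) o a₁ a₂ a₃ b := by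
  unfold HCov
  rw [Gc_restrict S hS]

end Functionals

section Chord

variable {V : Type*} {E : Type*} [Fintype E] [DecidableEq E] [DecidableEq V] {R : Type*} [Field R]
  [LinearOrder R]

variable (S : Finset E) {p : E → R} (hS : ∀ e, e ∉ S → p e = 0) (ends : E → Sym2 V)
  (o a₁ a₂ a₃ b : V) {f : E} (hf : f ∈ S)

include hS

omit [LinearOrder R] in
/-- The pinned instances transport too. -/
lemma Gc_restrict_update (c : R) :
    Gc (Function.update p f c) ends o a₁ a₂ a₃ b =
      Gc (Function.update (restrict S p) ⟨f, hf⟩ c) (restrictEnds S ends) o a₁ a₂ a₃ b := by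
  classical
  rw [Gc_restrict S (update_zero_off S hS hf c), restrict_update S p hf c]

/-- **The `D`-chord along an edge of positive weight is the `D`-chord of the restricted instance.** -/
theorem nMixChord_normD_restrict_iff :
    NMixChord (normD ends a₁ a₂ a₃) p ends o a₁ a₂ a₃ b f ↔
      NMixChord (normD (restrictEnds S ends) a₁ a₂ a₃) (restrict S p) (restrictEnds S ends)
        o a₁ a₂ a₃ b ⟨f, hf⟩ := by
  classical
  unfold NMixChord
  rw [Gc_restrict S hS, Gc_restrict_update S hS ends o a₁ a₂ a₃ b hf 0,
    Gc_restrict_update S hS ends o a₁ a₂ a₃ b hf 1, normD_restrict S hS,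
    normD_restrict S (update_zero_off S hS hf 0), restrict_update S p hf 0]
  rfl

/-- The `D·Z`-chord transports. -/
theorem nMixChord_normDZ_restrict_iff :
    NMixChord (normDZ ends a₁ a₂ a₃) p ends o a₁ a₂ a₃ b f ↔
      NMixChord (normDZ (restrictEnds S ends) a₁ a₂ a₃) (restrict S p) (restrictEnds S ends)
        o a₁ a₂ a₃ b ⟨f, hf⟩ := by
  classical
  unfold NMixChord
  rw [Gc_restrict S hS, Gc_restrict_update S hS ends o a₁ a₂ a₃ b hf 0,
    Gc_restrict_update S hS ends o a₁ a₂ a₃ b hf 1, normDZ_restrict S hS,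
    normDZ_restrict S (update_zero_off S hS hf 0), restrict_update S p hf 0]
  rfl

/-- The `(D·Z)²`-chord transports. -/
theorem nMixChord_normDZ2_restrict_iff :
    NMixChord (normDZ2 ends a₁ a₂ a₃) p ends o a₁ a₂ a₃ b f ↔
      NMixChord (normDZ2 (restrictEnds S ends) a₁ a₂ a₃) (restrict S p) (restrictEnds S ends)
        o a₁ a₂ a₃ b ⟨f, hf⟩ := by
  classical
  unfold NMixChord
  rw [Gc_restrict S hS, Gc_restrict_update S hS ends o a₁ a₂ a₃ b hf 0,
    Gc_restrict_update S hS ends o a₁ a₂ a₃ b hf 1, normDZ2_restrict S hS,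
    normDZ2_restrict S (update_zero_off S hS hf 0), restrict_update S p hf 0]
  rfl

end Chord

end Support

end Mix

end Summit.Ventures.PercRepro2
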